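import Summits.QuantumFields.YangMills.Theorems.UnitScaleTiltProp7LineAvgTridiagonal
import HarnessLib

/-!
# Route `UnitScaleTilt`, crux K1 child «MinimiserStabilityRegPr» (stmt-QuantumFields-19200), registered stub `stub_prop7From14` (skeleton birth_v5
# 98cb23610ad7; leaf V3 «Prop 7 from a background (14)») — sub-lemma V3-C (linear core), part 3/3: **A `k`-UNIFORM RIGHT INVERSE OF THE
# STRAIGHT-LINE `k`-FOLD BLOCK AVERAGING `Q_k = LatticeFieldCalculus.bondAvgIter k`** with `‖HZ‖_∞ ≤ 3‖Z‖_∞`, `‖HZ‖_{ℓ¹} ≤ 6L^{kd}‖Z‖_{ℓ¹}`,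
# `‖HZ‖²_{ℓ²} ≤ 18L^{kd}‖Z‖²_{ℓ²}`, constants independent of `k` and of the volume; instance at the d = 3 carrier

Cell `ym3-torus` ∕ fleet seat `ym-ust-19200-p1` (gen 3).  Third file of the series (`UnitScaleTiltProp7LineAvgTwoBlock`: two-block form of `M_k`, the
tent-interpolation field `A_W`, `M_kA_W = TW` tridiagonal; `UnitScaleTiltProp7LineAvgTridiagonal`: a-priori estimates for `T`, key constant).
WHY ([Balaban1985Variational] Sect. C p. 285): the chart (47) `A = A′ − HD(A′)` mapping the linear constraint onto the averaging fibre needs a right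
inverse `H` of the linearised averaging with `|HB| ≤ B₀|B|` in SUP norm, `B₀` independent of `k` ((45)–(46)); for the ℓ²-engine of this item
(p451004–p483802) the `ℓ¹`/`ℓ²` bounds serve the secant–tangent correction of the fibre.  At the flat background the main term of the family's
linearised `k`-fold (0.4)-averaging is `M_k = bondAvgIter k` (p454029; the true one-step linearisation is `L·bondAvg ∘ R₀` minus comb terms,
`BlockAveragingEMLLinearised`, whose right inverse is `H` followed by a coarse gauge correction — not done here).

WHAT IS PROVED HERE (sorry-free, no definition).
* §6 bounds of the tent-interpolation field `A_W` of a coarse field `W` (written as a hypothesis `hA` on a fine field `A`): `adjField_abs_le`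
  (`|A(b)| ≤ L^{−kd}max|W|`), `adjField_sum_abs_le` (`Σ|A| ≤ 2Σ|W|`), `adjField_sum_sq_le` (`ΣA² ≤ 2L^{−kd}ΣW²`); fine bond sums block by block
  (`sum_pbond_fine_eq`).
* §7 **`exists_rightInverse_lineAvg`**: on every torus of `Setup` lying `k` block levels above `T^{(k)}` there is a LINEAR `H` (coarse bond fields →
  fine bond fields) with `M_k(HZ) = Z`, `max|HZ| ≤ 3max|Z|`, `Σ|HZ| ≤ 6L^{kd}Σ|Z|`, `Σ(HZ)² ≤ 18L^{kd}ΣZ²` (`H = A ∘ T⁻¹`, `T` bijective by the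
  sup estimate and `LinearMap.injective_iff_surjective`); **`exists_rightInverse_bondAvgIter`** (the same for `Q_k` of record, standing range);
  **`exists_rightInverse_bondAvgIter_T3`** (the d = 3 carrier of `T3Thm1Carrier.varProblem3 F n K`: fine torus `Site (F.P K) 0`, `k = K − n`,
  constants `3`, `6L^{3(K−n)}`, `18L^{3(K−n)}`, uniform in `m`, `n`, `K`).

HONEST SCOPE.  [Balaban1985Variational] (45)–(46) at the FLAT background for the MAIN TERM only, with the tent (minimal-`ℓ²`-type) right inverse in
place of print's `G`-weighted one (allowed by p. 287); no Landau condition on `HZ`; the gradient bound of (46) is not stated (along the bond's axis the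
interpolant's increments are `(L^{kd}L^k)⁻¹(W(ȳ) − W(ȳ−e_μ))`, across transverse block faces they are `O(L^{−kd}max|W|)` — top-scale size, as (46)
at `j = k`).  Nothing of Bałaban's is asserted.

References: T. Bałaban, CMP 102 (1985) 277–309 [Balaban1985Variational] ((45)–(47) p.285, p.287); CMP 95 (1984) 17–40 [Balaban1984PropagatorsI]
((1.18) p.20).
-/

noncomputable section

open scoped BigOperators

namespace Summit.QuantumFields.YangMills.Theorems.Prop7LineAvgRightInverse

open Literature.MathematicalPhysics.QuantumFieldTheory.Balaban1983to89
open Finset LatticeFieldCalculus B1RG242Torus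
open B10StarCount (sum_pbond)
open Summit.QuantumFields.YangMills.Theorems.Prop7FlatCoercivity (iterate_shift_eq_runSite runSite_runSite runSite_apply_self
  runSite_apply_of_ne fibreSite_runSite sum_fibre_eq_sum_offsets)

variable {P : Params} {k : ℕ}

/-! ## §6 Bounds of the transpose-type field in terms of the coarse field -/

section AdjBounds

variable (h : P.sitesPerDir 0 = P.L ^ k * P.sitesPerDir k)
include h

/-- A sum over the fine bonds, block by block and offset by offset. [folklore] -/
theorem sum_pbond_fine_eq (G : PBond P 0 → ℝ) :
    ∑ b : PBond P 0, G b = ∑ μ : Fin P.d, ∑ y : Site P k, ∑ r : Fin P.d → Fin (P.L ^ k), G ⟨Site.fibreSite 0 k y r, μ⟩ := by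
  rw [sum_pbond, Finset.sum_comm]
  refine Finset.sum_congr rfl fun μ _ => ?_
  rw [← Finset.sum_fiberwise_of_maps_to (s := (univ : Finset (Site P 0))) (t := (univ : Finset (Site P k)))
    (g := Site.proj k k) (f := fun x => G ⟨x, μ⟩) (fun x _ => mem_univ _)]
  exact Finset.sum_congr rfl fun y _ => sum_fibre_eq_sum_offsets h y _

omit h in
/-- A coarse bond field summed direction by direction and site by site. [folklore] -/
theorem sum_dir_site_eq (F : PBond P k → ℝ) : ∑ μ : Fin P.d, ∑ y : Site P k, F ⟨y, μ⟩ = ∑ c : PBond P k, F c := by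
  rw [sum_pbond, Finset.sum_comm]

variable (W : PBond P k → ℝ) (A : PBond P 0 → ℝ)
  (hA : ∀ b : PBond P 0, A b = (((P.L : ℝ) ^ k) ^ P.d * (P.L : ℝ) ^ k)⁻¹ *
    (((((b.src b.dir).val % P.L ^ k : ℕ) : ℝ) + 1) * W ⟨Site.proj k k b.src, b.dir⟩
      + ((P.L ^ k - 1 - (b.src b.dir).val % P.L ^ k : ℕ) : ℝ) * W ⟨(Site.proj k k b.src).unshift b.dir, b.dir⟩))
include hA

omit h in
/-- **SUP BOUND OF THE TRANSPOSE FIELD**: `|A(b)| ≤ (L^k)^{−d}·max|W|` (the two tent weights at a bond add up to `L^k`). [folklore] -/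
theorem adjField_abs_le {B : ℝ} (hW : ∀ c : PBond P k, |W c| ≤ B) (b : PBond P 0) : |A b| ≤ (((P.L : ℝ) ^ k) ^ P.d)⁻¹ * B := by
  have hN : (0 : ℝ) < (P.L : ℝ) ^ k := pow_pos (by exact_mod_cast P.L_pos) k
  have hs : (b.src b.dir).val % P.L ^ k < P.L ^ k := Nat.mod_lt _ (pow_pos P.L_pos k)
  have hsum : ((((b.src b.dir).val % P.L ^ k : ℕ) : ℝ) + 1) + ((P.L ^ k - 1 - (b.src b.dir).val % P.L ^ k : ℕ) : ℝ) = (P.L : ℝ) ^ k := by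
    have : (b.src b.dir).val % P.L ^ k + 1 + (P.L ^ k - 1 - (b.src b.dir).val % P.L ^ k) = P.L ^ k := by omega
    have := congrArg (fun m : ℕ => (m : ℝ)) this
    push_cast at this
    linarith
  have hB : 0 ≤ B := (abs_nonneg _).trans (hW ⟨Site.proj k k b.src, b.dir⟩)
  have ha0 : (0 : ℝ) ≤ (((b.src b.dir).val % P.L ^ k : ℕ) : ℝ) + 1 := by positivity
  have hb0 : (0 : ℝ) ≤ ((P.L ^ k - 1 - (b.src b.dir).val % P.L ^ k : ℕ) : ℝ) := by positivity
  have hC0 : (0 : ℝ) ≤ (((P.L : ℝ) ^ k) ^ P.d * (P.L : ℝ) ^ k)⁻¹ := by positivity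
  rw [hA, abs_mul, abs_of_nonneg hC0]
  have h1 := hW ⟨Site.proj k k b.src, b.dir⟩
  have h2 := hW ⟨(Site.proj k k b.src).unshift b.dir, b.dir⟩
  have h3 : |((((b.src b.dir).val % P.L ^ k : ℕ) : ℝ) + 1) * W ⟨Site.proj k k b.src, b.dir⟩
      + ((P.L ^ k - 1 - (b.src b.dir).val % P.L ^ k : ℕ) : ℝ) * W ⟨(Site.proj k k b.src).unshift b.dir, b.dir⟩|
      ≤ (P.L : ℝ) ^ k * B := by
    refine (abs_add_le _ _).trans ?_
    rw [abs_mul, abs_mul, abs_of_nonneg ha0, abs_of_nonneg hb0, ← hsum]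
    nlinarith [mul_le_mul_of_nonneg_left h1 ha0, mul_le_mul_of_nonneg_left h2 hb0]
  calc (((P.L : ℝ) ^ k) ^ P.d * (P.L : ℝ) ^ k)⁻¹ * |((((b.src b.dir).val % P.L ^ k : ℕ) : ℝ) + 1) * W ⟨Site.proj k k b.src, b.dir⟩
        + ((P.L ^ k - 1 - (b.src b.dir).val % P.L ^ k : ℕ) : ℝ) * W ⟨(Site.proj k k b.src).unshift b.dir, b.dir⟩|
      ≤ (((P.L : ℝ) ^ k) ^ P.d * (P.L : ℝ) ^ k)⁻¹ * ((P.L : ℝ) ^ k * B) := mul_le_mul_of_nonneg_left h3 hC0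
    _ = (((P.L : ℝ) ^ k) ^ P.d)⁻¹ * B := by field_simp

/-- **`ℓ¹` BOUND OF THE TRANSPOSE FIELD**: `Σ_b |A(b)| ≤ 2·Σ_c |W(c)|`. [folklore] -/
theorem adjField_sum_abs_le : ∑ b : PBond P 0, |A b| ≤ 2 * ∑ c : PBond P k, |W c| := by
  have hN : (0 : ℝ) < (P.L : ℝ) ^ k := pow_pos (by exact_mod_cast P.L_pos) k
  rw [sum_pbond_fine_eq h]
  simp only [adjField_fibreSite h W A hA]
  have hpt : ∀ (μ : Fin P.d) (y : Site P k) (r : Fin P.d → Fin (P.L ^ k)),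
      |(((P.L : ℝ) ^ k) ^ P.d * (P.L : ℝ) ^ k)⁻¹ * ((((r μ : ℕ) : ℝ) + 1) * W ⟨y, μ⟩ + ((P.L ^ k - 1 - (r μ : ℕ) : ℕ) : ℝ) * W ⟨y.unshift μ, μ⟩)|
        ≤ (((P.L : ℝ) ^ k) ^ P.d * (P.L : ℝ) ^ k)⁻¹ * ((P.L : ℝ) ^ k * (|W ⟨y, μ⟩| + |W ⟨y.unshift μ, μ⟩|)) := by
    intro μ y r
    have ha : (((r μ : ℕ) : ℝ) + 1) ≤ (P.L : ℝ) ^ k := by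
      have := (r μ).isLt
      have : ((r μ : ℕ) : ℝ) + 1 ≤ ((P.L ^ k : ℕ) : ℝ) := by exact_mod_cast this
      push_cast at this; linarith
    have hb : ((P.L ^ k - 1 - (r μ : ℕ) : ℕ) : ℝ) ≤ (P.L : ℝ) ^ k := by
      have : ((P.L ^ k - 1 - (r μ : ℕ) : ℕ) : ℝ) ≤ ((P.L ^ k : ℕ) : ℝ) := by exact_mod_cast (by omega)
      push_cast at this; linarith
    have ha0 : (0 : ℝ) ≤ ((r μ : ℕ) : ℝ) + 1 := by positivity
    have hb0 : (0 : ℝ) ≤ ((P.L ^ k - 1 - (r μ : ℕ) : ℕ) : ℝ) := by positivity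
    have hC0 : (0 : ℝ) ≤ (((P.L : ℝ) ^ k) ^ P.d * (P.L : ℝ) ^ k)⁻¹ := by positivity
    rw [abs_mul, abs_of_nonneg hC0]
    refine mul_le_mul_of_nonneg_left ?_ hC0
    refine (abs_add_le _ _).trans ?_
    rw [abs_mul, abs_mul, abs_of_nonneg ha0, abs_of_nonneg hb0, mul_add]
    gcongr
  refine (Finset.sum_le_sum fun μ _ => Finset.sum_le_sum fun y _ => Finset.sum_le_sum fun r _ => hpt μ y r).trans ?_
  simp only [Finset.sum_const, Finset.card_univ, Fintype.card_fun, Fintype.card_fin, nsmul_eq_mul, Nat.cast_pow]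
  simp only [← Finset.mul_sum, Finset.sum_add_distrib]
  rw [sum_dir_site_eq (fun c => |W c|), sum_dir_site_eq (fun c => |W ⟨c.src.unshift c.dir, c.dir⟩|), sum_pbond_unshift (fun c => |W c|)]
  have e : ((P.L : ℝ) ^ k) ^ P.d * ((((P.L : ℝ) ^ k) ^ P.d * (P.L : ℝ) ^ k)⁻¹ * ((P.L : ℝ) ^ k *
      (∑ c : PBond P k, |W c| + ∑ c : PBond P k, |W c|))) = 2 * ∑ c : PBond P k, |W c| := by
    field_simp; ring
  rw [e]

/-- **`ℓ²` BOUND OF THE TRANSPOSE FIELD**: `Σ_b A(b)² ≤ 2(L^k)^{−d}·Σ_c W(c)²`. [folklore] -/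
theorem adjField_sum_sq_le : ∑ b : PBond P 0, (A b) ^ 2 ≤ 2 * (((P.L : ℝ) ^ k) ^ P.d)⁻¹ * ∑ c : PBond P k, (W c) ^ 2 := by
  have hN : (0 : ℝ) < (P.L : ℝ) ^ k := pow_pos (by exact_mod_cast P.L_pos) k
  rw [sum_pbond_fine_eq h]
  simp only [adjField_fibreSite h W A hA]
  have hpt : ∀ (μ : Fin P.d) (y : Site P k) (r : Fin P.d → Fin (P.L ^ k)),
      ((((P.L : ℝ) ^ k) ^ P.d * (P.L : ℝ) ^ k)⁻¹ * ((((r μ : ℕ) : ℝ) + 1) * W ⟨y, μ⟩ + ((P.L ^ k - 1 - (r μ : ℕ) : ℕ) : ℝ) * W ⟨y.unshift μ, μ⟩)) ^ 2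
        ≤ ((((P.L : ℝ) ^ k) ^ P.d * (P.L : ℝ) ^ k)⁻¹) ^ 2 * (((P.L : ℝ) ^ k) ^ 2 * ((W ⟨y, μ⟩) ^ 2 + (W ⟨y.unshift μ, μ⟩) ^ 2)) := by
    intro μ y r
    have hsum : ((((r μ : ℕ) : ℝ) + 1)) + ((P.L ^ k - 1 - (r μ : ℕ) : ℕ) : ℝ) = (P.L : ℝ) ^ k := by
      have : (r μ : ℕ) + 1 + (P.L ^ k - 1 - (r μ : ℕ)) = P.L ^ k := by have := (r μ).isLt; omega
      have := congrArg (fun m : ℕ => (m : ℝ)) this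
      push_cast at this; linarith
    set a : ℝ := ((r μ : ℕ) : ℝ) + 1 with ha_def
    set b : ℝ := ((P.L ^ k - 1 - (r μ : ℕ) : ℕ) : ℝ) with hb_def
    have ha0 : 0 ≤ a := by positivity
    have hb0 : 0 ≤ b := by positivity
    have haN : a ≤ (P.L : ℝ) ^ k := by linarith
    have hbN : b ≤ (P.L : ℝ) ^ k := by linarith
    rw [mul_pow]
    refine mul_le_mul_of_nonneg_left ?_ (by positivity)
    -- `(au + bv)² ≤ (a+b)(au² + bv²) ≤ N·N(u² + v²)`
    have h1 : (a * W ⟨y, μ⟩ + b * W ⟨y.unshift μ, μ⟩) ^ 2 ≤ (a + b) * (a * (W ⟨y, μ⟩) ^ 2 + b * (W ⟨y.unshift μ, μ⟩) ^ 2) := by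
      have : (a + b) * (a * (W ⟨y, μ⟩) ^ 2 + b * (W ⟨y.unshift μ, μ⟩) ^ 2) - (a * W ⟨y, μ⟩ + b * W ⟨y.unshift μ, μ⟩) ^ 2
          = a * b * (W ⟨y, μ⟩ - W ⟨y.unshift μ, μ⟩) ^ 2 := by ring
      nlinarith [mul_nonneg (mul_nonneg ha0 hb0) (sq_nonneg (W ⟨y, μ⟩ - W ⟨y.unshift μ, μ⟩))]
    rw [hsum] at h1
    have h2 : a * (W ⟨y, μ⟩) ^ 2 + b * (W ⟨y.unshift μ, μ⟩) ^ 2 ≤ (P.L : ℝ) ^ k * ((W ⟨y, μ⟩) ^ 2 + (W ⟨y.unshift μ, μ⟩) ^ 2) := by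
      rw [mul_add]; gcongr
    calc (a * W ⟨y, μ⟩ + b * W ⟨y.unshift μ, μ⟩) ^ 2
        ≤ (P.L : ℝ) ^ k * (a * (W ⟨y, μ⟩) ^ 2 + b * (W ⟨y.unshift μ, μ⟩) ^ 2) := h1
      _ ≤ (P.L : ℝ) ^ k * ((P.L : ℝ) ^ k * ((W ⟨y, μ⟩) ^ 2 + (W ⟨y.unshift μ, μ⟩) ^ 2)) := mul_le_mul_of_nonneg_left h2 hN.le
      _ = ((P.L : ℝ) ^ k) ^ 2 * ((W ⟨y, μ⟩) ^ 2 + (W ⟨y.unshift μ, μ⟩) ^ 2) := by ring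
  refine (Finset.sum_le_sum fun μ _ => Finset.sum_le_sum fun y _ => Finset.sum_le_sum fun r _ => hpt μ y r).trans ?_
  simp only [Finset.sum_const, Finset.card_univ, Fintype.card_fun, Fintype.card_fin, nsmul_eq_mul, Nat.cast_pow]
  simp only [← Finset.mul_sum, Finset.sum_add_distrib]
  rw [sum_dir_site_eq (fun c => (W c) ^ 2), sum_dir_site_eq (fun c => (W ⟨c.src.unshift c.dir, c.dir⟩) ^ 2),
    sum_pbond_unshift (fun c => (W c) ^ 2)]
  have e : ((P.L : ℝ) ^ k) ^ P.d * (((((P.L : ℝ) ^ k) ^ P.d * (P.L : ℝ) ^ k)⁻¹) ^ 2 * (((P.L : ℝ) ^ k) ^ 2 *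
      (∑ c : PBond P k, (W c) ^ 2 + ∑ c : PBond P k, (W c) ^ 2))) = 2 * (((P.L : ℝ) ^ k) ^ P.d)⁻¹ * ∑ c : PBond P k, (W c) ^ 2 := by
    field_simp; ring
  rw [e]

end AdjBounds

/-! ## §7 The right inverse -/

section RightInverse

/-- **A `k`-UNIFORM RIGHT INVERSE OF THE STRAIGHT-LINE `k`-FOLD BLOCK AVERAGING** ([Balaban1985Variational] (45)–(46) «L^jη Q_j H B = B …
|HB| ≤ B₀(L^jη)⁻¹|B|» at the flat background and the top scale, for the main term `M_k` of the linearised averaging; print's `H` is the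
`G`-weighted right inverse of [Balaban1984PropagatorsI] (3.126), «by no means a unique choice» (p. 287) — here the tent-interpolation one):
on every torus of `Setup` lying `k` block levels above `T^{(k)}` there is a LINEAR map `H` from coarse bond fields to fine bond fields with
`M_k(HZ) = Z` and `‖HZ‖_∞ ≤ 3‖Z‖_∞`, `‖HZ‖_{ℓ¹} ≤ 6L^{kd}‖Z‖_{ℓ¹}`, `‖HZ‖²_{ℓ²} ≤ 18L^{kd}‖Z‖²_{ℓ²}` — constants independent of `k` and of the
volume (the natural scalings: `M_k` contracts sup norms by `1`, `ℓ¹` norms by `L^{−kd}` and `ℓ²` norms² by `L^{−kd}` at best).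
[cite: Balaban1985Variational, (45)-(46) p.285] -/
theorem exists_rightInverse_lineAvg (h : P.sitesPerDir 0 = P.L ^ k * P.sitesPerDir k) :
    ∃ H : (PBond P k → ℝ) →ₗ[ℝ] (PBond P 0 → ℝ), ∀ Z : PBond P k → ℝ,
      (∀ c : PBond P k, (((P.L : ℝ) ^ k) ^ P.d * (P.L : ℝ) ^ k)⁻¹ *
          ∑ x ∈ univ.filter (fun x : Site P 0 => Site.proj k k x = c.src), ∑ t ∈ range (P.L ^ k),
            H Z ⟨(fun z : Site P 0 => z.shift c.dir)^[t] x, c.dir⟩ = Z c) ∧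
      (∀ B : ℝ, (∀ c : PBond P k, |Z c| ≤ B) → ∀ b : PBond P 0, |H Z b| ≤ 3 * B) ∧
      (∑ b : PBond P 0, |H Z b| ≤ 6 * ((P.L : ℝ) ^ k) ^ P.d * ∑ c : PBond P k, |Z c|) ∧
      (∑ b : PBond P 0, (H Z b) ^ 2 ≤ 18 * ((P.L : ℝ) ^ k) ^ P.d * ∑ c : PBond P k, (Z c) ^ 2) := by
  classical
  have hN : (0 : ℝ) < (P.L : ℝ) ^ k := pow_pos (by exact_mod_cast P.L_pos) k
  -- the transpose-type map (tent interpolation) and the normal operator, as linear maps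
  let A : (PBond P k → ℝ) →ₗ[ℝ] (PBond P 0 → ℝ) :=
    { toFun := fun W b => (((P.L : ℝ) ^ k) ^ P.d * (P.L : ℝ) ^ k)⁻¹ *
        (((((b.src b.dir).val % P.L ^ k : ℕ) : ℝ) + 1) * W ⟨Site.proj k k b.src, b.dir⟩
          + ((P.L ^ k - 1 - (b.src b.dir).val % P.L ^ k : ℕ) : ℝ) * W ⟨(Site.proj k k b.src).unshift b.dir, b.dir⟩)
      map_add' := fun W₁ W₂ => by funext b; simp only [Pi.add_apply]; ring
      map_smul' := fun a W => by funext b; simp only [Pi.smul_apply, smul_eq_mul, RingHom.id_apply]; ring }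
  let α : ℝ := ∑ s : Fin (P.L ^ k), ((((s : ℕ) : ℝ) + 1) ^ 2 + (((P.L ^ k - 1 - (s : ℕ) : ℕ) : ℝ)) ^ 2)
  let γ : ℝ := ∑ s : Fin (P.L ^ k), (((s : ℕ) : ℝ) + 1) * ((P.L ^ k - 1 - (s : ℕ) : ℕ) : ℝ)
  let D : ℝ := (((P.L : ℝ) ^ k) ^ P.d * (P.L : ℝ) ^ k)⁻¹ * ((((P.L ^ k : ℕ) : ℝ) ^ (P.d - 1)) *
      (((P.L : ℝ) ^ k) ^ P.d * (P.L : ℝ) ^ k)⁻¹)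
  let T : (PBond P k → ℝ) →ₗ[ℝ] (PBond P k → ℝ) :=
    { toFun := fun W c => D * (α * W c + γ * W ⟨c.src.unshift c.dir, c.dir⟩ + γ * W ⟨runSite c.src c.dir 1, c.dir⟩)
      map_add' := fun W₁ W₂ => by funext c; simp only [Pi.add_apply]; ring
      map_smul' := fun a W => by funext c; simp only [Pi.smul_apply, smul_eq_mul, RingHom.id_apply]; ring }
  have hD : 0 ≤ D := by positivity
  have hγ : 0 ≤ γ := tent_gamma_nonneg _
  have hK : (0 : ℝ) ≤ 3 * ((P.L : ℝ) ^ k) ^ P.d := by positivity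
  have key : 1 ≤ 3 * ((P.L : ℝ) ^ k) ^ P.d * (D * (α - 2 * γ)) := key_dominance P k
  -- `M_k ∘ A = T`
  have hMA : ∀ (W : PBond P k → ℝ) (c : PBond P k), (((P.L : ℝ) ^ k) ^ P.d * (P.L : ℝ) ^ k)⁻¹ *
      ∑ x ∈ univ.filter (fun x : Site P 0 => Site.proj k k x = c.src), ∑ t ∈ range (P.L ^ k),
        A W ⟨(fun z : Site P 0 => z.shift c.dir)^[t] x, c.dir⟩ = T W c := by
    intro W c
    rw [lineAvg_adjField h W (A W) (fun b => rfl) c]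
    show _ = D * (α * W c + γ * W ⟨c.src.unshift c.dir, c.dir⟩ + γ * W ⟨runSite c.src c.dir 1, c.dir⟩)
    ring
  -- `T` is injective (sup a-priori estimate with `Z = 0`), hence bijective
  have hinj : Function.Injective T := by
    intro W₁ W₂ hW
    have h0 : ∀ c, T (W₁ - W₂) c = (0 : PBond P k → ℝ) c := fun c => by rw [map_sub, hW, sub_self]
    have hle := tridiag_sup_le D α γ (W₁ - W₂) 0 hD hγ h0 (3 * ((P.L : ℝ) ^ k) ^ P.d) hK key (B := 0)
      (fun c => by simp)
    funext c
    have hc := hle c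
    rw [mul_zero] at hc
    have : (W₁ - W₂) c = 0 := abs_nonpos_iff.mp hc
    simpa [sub_eq_zero] using this
  have hsurj : Function.Surjective T := LinearMap.injective_iff_surjective.mp hinj
  let E : (PBond P k → ℝ) ≃ₗ[ℝ] (PBond P k → ℝ) := LinearEquiv.ofBijective T ⟨hinj, hsurj⟩
  refine ⟨A ∘ₗ E.symm.toLinearMap, fun Z => ?_⟩
  set W : PBond P k → ℝ := E.symm Z with hWdef
  have hTW : ∀ c, T W c = Z c := by
    intro c
    have hE : E W = Z := E.apply_symm_apply Z
    rw [LinearEquiv.ofBijective_apply] at hE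
    rw [hE]
  have hTW' : ∀ c : PBond P k, D * (α * W c + γ * W ⟨c.src.unshift c.dir, c.dir⟩ + γ * W ⟨runSite c.src c.dir 1, c.dir⟩) = Z c := hTW
  have hAW : (A ∘ₗ E.symm.toLinearMap) Z = A W := rfl
  rw [hAW]
  have hAdef : ∀ b : PBond P 0, A W b = (((P.L : ℝ) ^ k) ^ P.d * (P.L : ℝ) ^ k)⁻¹ *
      (((((b.src b.dir).val % P.L ^ k : ℕ) : ℝ) + 1) * W ⟨Site.proj k k b.src, b.dir⟩
        + ((P.L ^ k - 1 - (b.src b.dir).val % P.L ^ k : ℕ) : ℝ) * W ⟨(Site.proj k k b.src).unshift b.dir, b.dir⟩) := fun b => rfl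
  refine ⟨fun c => by rw [hMA W c, hTW c], fun B hZ b => ?_, ?_, ?_⟩
  · -- sup bound
    have hW := tridiag_sup_le D α γ W Z hD hγ hTW' (3 * ((P.L : ℝ) ^ k) ^ P.d) hK key hZ
    have := adjField_abs_le W (A W) hAdef hW b
    calc |A W b| ≤ (((P.L : ℝ) ^ k) ^ P.d)⁻¹ * (3 * ((P.L : ℝ) ^ k) ^ P.d * B) := this
      _ = 3 * B := by field_simp
  · -- ℓ¹ bound
    have hW := tridiag_l1_le D α γ W Z hD hγ hTW' (3 * ((P.L : ℝ) ^ k) ^ P.d) hK key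
    have := adjField_sum_abs_le h W (A W) hAdef
    nlinarith [this, hW]
  · -- ℓ² bound
    have hW := tridiag_l2_le D α γ W Z hD hγ hTW' (3 * ((P.L : ℝ) ^ k) ^ P.d) hK key
    have hA2 := adjField_sum_sq_le h W (A W) hAdef
    have hpos : (0 : ℝ) < ((P.L : ℝ) ^ k) ^ P.d := by positivity
    calc ∑ b : PBond P 0, (A W b) ^ 2 ≤ 2 * (((P.L : ℝ) ^ k) ^ P.d)⁻¹ * ∑ c : PBond P k, (W c) ^ 2 := hA2
      _ ≤ 2 * (((P.L : ℝ) ^ k) ^ P.d)⁻¹ * ((3 * ((P.L : ℝ) ^ k) ^ P.d) ^ 2 * ∑ c : PBond P k, (Z c) ^ 2) :=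
          mul_le_mul_of_nonneg_left hW (by positivity)
      _ = 18 * ((P.L : ℝ) ^ k) ^ P.d * ∑ c : PBond P k, (Z c) ^ 2 := by field_simp; ring

/-- **THE SAME FOR THE ITERATED LINEAR BOND AVERAGE OF RECORD** `Q_k = LatticeFieldCalculus.bondAvgIter k` ([Balaban1984PropagatorsI] (1.18), identified
with the straight-line block average by `Prop7FlatCoercivity.bondAvgIter_eq_lineBlockAvg`), `k` in the standing range: a linear right inverse `H` with
`Q_k(HZ) = Z`, `‖HZ‖_∞ ≤ 3‖Z‖_∞`, `‖HZ‖_{ℓ¹} ≤ 6L^{kd}‖Z‖_{ℓ¹}`, `‖HZ‖²_{ℓ²} ≤ 18L^{kd}‖Z‖²_{ℓ²}`, uniformly in `k` and in the volume.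
[cite: Balaban1985Variational, (45)-(46) p.285] -/
theorem exists_rightInverse_bondAvgIter (hk : k ≤ P.m + P.K) :
    ∃ H : (PBond P k → ℝ) →ₗ[ℝ] (PBond P 0 → ℝ), ∀ Z : VecField P k ℝ,
      bondAvgIter k (H Z) = Z ∧
      (∀ B : ℝ, (∀ c : PBond P k, |Z c| ≤ B) → ∀ b : PBond P 0, |H Z b| ≤ 3 * B) ∧
      (∑ b : PBond P 0, |H Z b| ≤ 6 * ((P.L : ℝ) ^ k) ^ P.d * ∑ c : PBond P k, |Z c|) ∧
      (∑ b : PBond P 0, (H Z b) ^ 2 ≤ 18 * ((P.L : ℝ) ^ k) ^ P.d * ∑ c : PBond P k, (Z c) ^ 2) := by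
  obtain ⟨H, hH⟩ := exists_rightInverse_lineAvg (Prop7FlatCoercivity.sitesPerDir_zero_eq_pow_mul hk)
  refine ⟨H, fun Z => ⟨?_, (hH Z).2⟩⟩
  funext c
  rw [Prop7FlatCoercivity.bondAvgIter_eq_lineBlockAvg_real hk]
  exact (hH Z).1 c

/-- **AT THE d = 3 CARRIER** of `T3Thm1Carrier.varProblem3 F n K` (fine torus `Site (F.P K) 0` of run `K`, `k = K − n` averaging levels down to
the comparison lattice): a linear right inverse `H` of `Q_{K−n}` on real bond fields with `‖HZ‖_∞ ≤ 3‖Z‖_∞`, `‖HZ‖_{ℓ¹} ≤ 6L^{3(K−n)}‖Z‖_{ℓ¹}`,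
`‖HZ‖²_{ℓ²} ≤ 18L^{3(K−n)}‖Z‖²_{ℓ²}`, uniformly in `m`, `n`, `K` — the linear core of the chart (47) `A = A′ − HD(A′)` of [Balaban1985Variational]
Sect. C for the family's straight-line main term. [cite: Balaban1985Variational, (45)-(47) p.285] -/
theorem exists_rightInverse_bondAvgIter_T3 (F : T3ContinuumYM3Torus.T3Family) (n K : ℕ) :
    ∃ H : (PBond (F.P K) (K - n) → ℝ) →ₗ[ℝ] (PBond (F.P K) 0 → ℝ), ∀ Z : VecField (F.P K) (K - n) ℝ,
      bondAvgIter (K - n) (H Z) = Z ∧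
      (∀ B : ℝ, (∀ c : PBond (F.P K) (K - n), |Z c| ≤ B) → ∀ b : PBond (F.P K) 0, |H Z b| ≤ 3 * B) ∧
      (∑ b : PBond (F.P K) 0, |H Z b| ≤ 6 * ((F.L : ℝ) ^ (K - n)) ^ 3 * ∑ c : PBond (F.P K) (K - n), |Z c|) ∧
      (∑ b : PBond (F.P K) 0, (H Z b) ^ 2 ≤ 18 * ((F.L : ℝ) ^ (K - n)) ^ 3 * ∑ c : PBond (F.P K) (K - n), (Z c) ^ 2) :=
  exists_rightInverse_bondAvgIter (P := F.P K) (show K - n ≤ F.m + K by omega)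

end RightInverse

end Summit.QuantumFields.YangMills.Theorems.Prop7LineAvgRightInverse

end
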